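import Summits.QuantumFields.YangMills.Theorems.BalabanUVNodesN15KingModelPotential

/-!
# Route «BalabanUVNodes» (K4 «SpineRates»), node N15 = NE2 — THE KING-MODEL RUNG, part 8b: THE TWO LETTERS OF THE POTENTIAL PERTURBATION AS
# THEOREMS ON KING'S TORI — locality from the minimiser's printed decay, the one-step two-spacing difference from Prop. 3.8 plus the COHERENCE
# DEFECT of the potentials; the socket's (H2′)∕(H3) letters for the generated tower; monotonicity of the socket's leaves in the rate

Cell `pub-ymgap`, Track A (D-0062), seat `pub-ymgap-dag-n15-d` (R134 seat, strategy s3, gen 6).  `bears_on: R4∕N15`; `--supports` the K3′ item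
`SpineGivenEndpointR12` (stmt-QuantumFields-19908).  COUNT-NEUTRAL; THEOREMS ONLY (0 `def`, 0 `sorry`; the volume abbreviations `kingM`∕`kingU` are part 8a §4).

CONTENTS (0 sorry).  §4 THE KING-ADMISSIBLE UNIT TORI `Π_μ ℤ∕(2L^{e+1})` spelled `kingU d L e = fine L (2L^e)` — at once the carrier of the lineage's
`kingTower`∕`kingCov`∕`kingCovE` (on `fine L M`) and a volume `sitesPerDir` of Bałaban's parameter records on which the tree's King minimiser theorems are
stated (`kingU_eq_sitesPerDir`); the factor bounds BY NAME, uniformly in the volume exponent `e`, the level `k ≥ 1` and the spelling of the fine count: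
`kingH_decay_kingU` (`|ℋ_k(x,b)| ≤ c·e^{−δ|B(x)−b|}` ⇐ `King1986.Torus.minimiser_row_decay` = Theorem 3.3 (3.7) ∕ [Ba 4] (1.10)) and `kingH_step_kingU`
(`|ℋ_{k+1}(x′,b) − ℋ_k(x,b)| ≤ C·(L^{−1∕2})^k·e^{−δ|B(x′)−b|}` ⇐ `king_prop38_torus_blocks` at `γ = 1`, `n = 1` = Prop. 3.8 (3.71) line 1, constant made
`k`-uniform by n18-e's `outerRate_le_unif`); then **`potLevel_letters_kingU`** — THE TWO LETTERS OF THE FIRST VARIATION AS THEOREMS: `∃ δ c > 0`, for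
every `e`, `k ≥ 1`: (LOCALITY) `|E_k(w)(b,b′)| ≤ w₀·c·e^{−δ|b−b′|}` for every potential `|w| ≤ w₀`; (TWO-SPACING) `|E_{k+1}(w′) − E_k(w)|(b,b′) ≤
c·(w₀·(L^{−1∕2})^k + ν)·e^{−δ|b−b′|}` for potentials bounded by `w₀` with coherence-defect `sup_{x′}|w′(x′) − w(x under x′)| ≤ ν` (part 8a §3 fired on
the factor bounds at a common rate).  §5 **`potTower_letters_kingU`** — for a potential TOWER `v` of size `sup|v_N| ≤ w₀`: the generated ℕ-tower
`potTower v` is k-uniformly LOCAL, `UniformKernelDecay (potTower v) |·|_T (w₀·c) κ` (the socket's (H2′)), and, if its coherence defect across one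
block-spin step is `≤ ν₀·s^k` (`0 ≤ s ≤ L^{−1∕2}`), has the geometric ONE-STEP SUP RATE `EffectiveOperatorSupRate (potTower v) (c·(w₀+ν₀)) L^{−1∕2}`
(the socket's (H3)) — BOTH DERIVED, linear in the size of the potential.  §6 monotonicity of the socket's leaves in the Combes–Thomas rate and the
ratio (`uniformKernelDecay_mono_rate`, `wRow_mono_rate`∕`wCol_mono_rate`, `uniformCTBound_mono_rate`, `effectiveOperatorSupRate_mono_rate`) and
`latticeConst_pos` — part 8c runs part 3's free leaves at the rate `min(κ′, κ)` the derived locality allows.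

HONEST FRAMING ∕ LIMITS.  As part 8a: King's `A = 0` scalar block-spin tower; the perturbation is the FIRST VARIATION along a scalar potential (not the
full dressed operator, not a gauge field); `L` odd `≥ 3` and the volumes `2L^{e+1}` are those of the tree's minimiser theorems (Bałaban's `T₁`); the
rate `L^{−1∕2}` is Prop. 3.8's `L^{−γk}` at `γ = 1` under the square root of the tree's statement; NOT Bałaban's `Δ^{(k)}(U) − Δ^{(k)}(1)` (η-differences
NOT PRINTED); NOT the carriers of record; NOT a node discharge; typed 28∕28, discharged count untouched; one finite torus programme at fixed ε — NOT
ℝ⁴ ∕ infinite volume ∕ OS ∕ mass gap ∕ Clay.  Locators only: [King1986] CMP **102** (1986): (2.13)–(2.15) p. 653, Theorem 3.3 (3.7) p. 658, Prop. 3.8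
(3.71) p. 664, Lemma 4.3 (4.18) p. 672, (4.34) p. 674, (4.41) p. 675; [Balaban1983RegularityDecay] CMP **89** (1983) Theorem (1.10) p. 573;
[Balaban1987RG1] CMP **109** (1987) (0.1) p. 251 (the volumes `2L^m`).
-/

noncomputable section

open scoped BigOperators
open Finset

namespace Summit.QuantumFields.YangMills.BalabanUVNodes.N15.KingModel

open Literature.MathematicalPhysics.QuantumFieldTheory.Balaban1983to89 hiding blockOf
open Literature.MathematicalPhysics.QuantumFieldTheory.Balaban1983to89.B4Sect5Proof (latticeConst latticeConst_nonneg)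
open Literature.MathematicalPhysics.QuantumFieldTheory.Balaban1983to89.B5Prop11Plancherel (Tor fine)
open Literature.MathematicalPhysics.QuantumFieldTheory.King1986 (aK aK_le aK_pos prop38RateConst prop38PosConst lemma43Const wRow wCol)
open Literature.MathematicalPhysics.QuantumFieldTheory.King1986.Torus (minimiser blockOf tdistT tdistT_isPseudoDist tdistT_sumBound
  minimiser_row_decay king_prop38_torus_blocks)
open Summit.QuantumFields.BalabanUV.T4Continuum.NE2KingTransplant (IsPseudoMetric UniformCoercive UniformCTBound UniformKernelDecay
  EffectiveOperatorSupRate VolumeSum)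
open Summit.QuantumFields.YangMills.BalabanUVNodes.N15KingModelRung (kingH)
open Summit.QuantumFields.YangMills.BalabanUVNodes.N15KingModelRung.Curved (underPtN val_underPtN blockOf_underPtN)
open Summit.QuantumFields.YangMills.BalabanUVNodes.N18KingModelTorus (outerRate_le_unif)

variable {d : ℕ}

/-! ## §4 King's volumes: the minimiser's decay and Prop. 3.8 step BY NAME, and THE TWO LETTERS AS THEOREMS -/

section King

open Real

variable (L : ℕ) [NeZero L]

omit [NeZero L] in
/-- `L·2L^e = sitesPerDir` of the record `(d+1, L, e+1, k)` at its own number of scales `k`. [cite: Balaban1987RG1, (0.1) p.251] -/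
theorem kingU_eq_sitesPerDir (hLodd : Odd L) (hL : 2 ≤ L) (e k : ℕ) :
    ∀ μ, kingU d L e μ = (⟨d + 1, L, e + 1, k, Nat.succ_pos d, hLodd, by omega⟩ : Params).sitesPerDir k := by
  intro μ
  simp [kingU, kingM, fine, Params.sitesPerDir, pow_succ]
  ring

/-- **THE UNIFORM DECAY OF KING'S MINIMISER ON THE KING-ADMISSIBLE TORI** (Theorem 3.3 (3.7) ∕ [Ba 4] (1.10) for the minimiser, the tree's
`King1986.Torus.minimiser_row_decay` BY NAME, `a_k ≤ a`): `∃ δ c > 0` with `|ℋ_k(x, b)| ≤ c·e^{−δ|B(x) − b|}` for every volume exponent, every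
`k ≥ 1`, every spelling `N = L^k` of the fine count, every block and fine point. [cite: King1986, Theorem 3.3 (3.7) p.658; Balaban1983RegularityDecay, Theorem (1.10) p.573] -/
theorem kingH_decay_kingU (hLodd : Odd L) (hL : 2 ≤ L) {a m2 : ℝ} (ha : 0 < a) (hm : 0 ≤ m2) :
    ∃ δ c : ℝ, 0 < δ ∧ 0 < c ∧ ∀ (e k : ℕ), 1 ≤ k → ∀ (N : ℕ) [NeZero N], N = L ^ k →
      ∀ (b : Tor (kingU d L e)) (x : Tor (fine N (kingU d L e))),
        |kingH L N (kingU d L e) a m2 k b x| ≤ c * Real.exp (-(δ * tdistT (kingU d L e) (blockOf N (kingU d L e) x) b)) := by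
  have hL1 : 1 < L := by omega
  obtain ⟨δ₀, c₀, hδ₀, hc₀, H⟩ := minimiser_row_decay (d + 1) L (Nat.succ_pos d) ⟨hLodd, hL1⟩ ha hm
  refine ⟨δ₀, a * c₀, hδ₀, mul_pos ha hc₀, fun e k hk N _ hN b x => ?_⟩
  exact H ⟨d + 1, L, e + 1, k, Nat.succ_pos d, hLodd, hL1⟩ rfl rfl hk (kingU d L e) (kingU_eq_sitesPerDir L hLodd hL e k) N hN
    δ₀ hδ₀ le_rfl x b

/-- **KING'S PROP. 3.8 STEP ON THE KING-ADMISSIBLE TORI, UNIFORMLY** ((3.71) line 1 at `γ = 1`, `n = 1`: the tree's `king_prop38_torus_blocks` BY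
NAME, its constant `√((C₁(k,1) + C₂)·L^{−k}·2ac₀)` majorised uniformly in `k` by n18-e's `outerRate_le_unif`): `∃ δ C > 0` with
`|ℋ_{k+1}(x′, b) − ℋ_k(x, b)| ≤ C·(L^{−1∕2})^k·e^{−δ|B(x′) − b|}` for every volume exponent, `k ≥ 1`, block `b`, fine point `x′` of the finer run
(`x` under it). [cite: King1986, Prop. 3.8 (3.71) p.664 (first line)] -/
theorem kingH_step_kingU (hLodd : Odd L) (hL : 2 ≤ L) {a m2 : ℝ} (ha : 0 < a) (hm : 0 < m2) :
    ∃ δ C : ℝ, 0 < δ ∧ 0 < C ∧ ∀ (e k : ℕ), 1 ≤ k → ∀ (b : Tor (kingU d L e)) (x' : Tor (fine (L ^ 1 * L ^ k) (kingU d L e))),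
      |kingH L (L ^ 1 * L ^ k) (kingU d L e) a m2 (k + 1) b x' - kingH L (L ^ k) (kingU d L e) a m2 k b (underPtN L k 1 (kingU d L e) x')|
        ≤ C * ((L : ℝ) ^ (-(1 / 2 : ℝ))) ^ k * Real.exp (-(δ * tdistT (kingU d L e) (blockOf (L ^ 1 * L ^ k) (kingU d L e) x') b)) := by
  have hL1 : 1 < L := by omega
  obtain ⟨δ₀, c₀, hδ₀, hc₀, H⟩ := king_prop38_torus_blocks (d + 1) L (Nat.succ_pos d) hLodd hL ha hm (γ := 1) zero_le_one le_rfl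
  set Cu : ℝ := prop38RateConst a a (a * (2 * ((a * (1 - ((L : ℝ) ^ 2)⁻¹))⁻¹ + π ^ 2 / 48 + 1 / 3)))
      ((π ^ 2 / 4) ^ (d + 1)) (d + 1) 1 + prop38PosConst a ((π ^ 2 / 4) ^ (d + 1)) (d + 1) 1 with hCu
  refine ⟨δ₀ / 2, Real.sqrt (2 * (a * c₀) * Cu) + 1, half_pos hδ₀, by positivity, fun e k hk b x' => ?_⟩
  have hj := H ⟨d + 1, L, e + 1, k, Nat.succ_pos d, hLodd, hL1⟩ rfl rfl hk 1 le_rfl (kingU d L e) (kingU_eq_sitesPerDir L hLodd hL e k)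
    (underPtN L k 1 (kingU d L e) x') x' b (val_underPtN L k 1 (kingU d L e) x')
  set s : ℝ := (L : ℝ) ^ (-(1 / 2 : ℝ)) with hs_def
  have hs : 0 ≤ s := Real.rpow_nonneg (Nat.cast_nonneg _) _
  set E : ℝ := Real.exp (-(δ₀ / 2 * tdistT (kingU d L e) (blockOf (L ^ 1 * L ^ k) (kingU d L e) x') b)) with hE
  have hstep : |kingH L (L ^ 1 * L ^ k) (kingU d L e) a m2 (k + 1) b x' - kingH L (L ^ k) (kingU d L e) a m2 k b (underPtN L k 1 (kingU d L e) x')|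
      ≤ Real.sqrt ((prop38RateConst a a (lemma43Const a L k 1) ((π ^ 2 / 4) ^ (d + 1)) (d + 1) 1
            + prop38PosConst a ((π ^ 2 / 4) ^ (d + 1)) (d + 1) 1) * ((L ^ k : ℕ) : ℝ) ^ (-(1 : ℝ)) * (2 * (a * c₀)))
        * Real.exp (-(δ₀ / 2 * tdistT (kingU d L e) (blockOf (L ^ k) (kingU d L e) (underPtN L k 1 (kingU d L e) x')) b)) := hj
  rw [blockOf_underPtN] at hstep
  have hC := outerRate_le_unif (d := d + 1) (Nat.succ_pos d) ha hL hk (le_refl 1) (le_refl (1 : ℝ)) hc₀.le (K := k)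
  calc |kingH L (L ^ 1 * L ^ k) (kingU d L e) a m2 (k + 1) b x' - kingH L (L ^ k) (kingU d L e) a m2 k b (underPtN L k 1 (kingU d L e) x')|
      ≤ Real.sqrt ((prop38RateConst a a (lemma43Const a L k 1) ((π ^ 2 / 4) ^ (d + 1)) (d + 1) 1
            + prop38PosConst a ((π ^ 2 / 4) ^ (d + 1)) (d + 1) 1) * ((L ^ k : ℕ) : ℝ) ^ (-(1 : ℝ)) * (2 * (a * c₀))) * E := hstep
    _ ≤ Real.sqrt (2 * (a * c₀) * Cu) * s ^ k * E := mul_le_mul_of_nonneg_right hC (Real.exp_pos _).le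
    _ ≤ (Real.sqrt (2 * (a * c₀) * Cu) + 1) * s ^ k * E :=
        mul_le_mul_of_nonneg_right (mul_le_mul_of_nonneg_right (by linarith) (pow_nonneg hs _)) (Real.exp_pos _).le

/-- Decay bounds weaken with the rate. [folklore] -/
theorem decay_mono {c κ κ' t : ℝ} (hc : 0 ≤ c) (hκ : κ' ≤ κ) (ht : 0 ≤ t) {A : ℝ} (h : A ≤ c * Real.exp (-(κ * t))) :
    A ≤ c * Real.exp (-(κ' * t)) :=
  h.trans (mul_le_mul_of_nonneg_left (Real.exp_le_exp.mpr (by nlinarith)) hc)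

/-- **THE TWO LETTERS OF THE FIRST VARIATION, AS THEOREMS, ON KING'S TORI.**  For odd `L ≥ 3`, `a, m² > 0`, dimension `d + 1`, there are
`δ, c > 0` such that for every volume exponent `e` and every `k ≥ 1`:
(LOCALITY) for every bounded potential `|w| ≤ w₀` on the level-`k` fine torus (any spelling `N = L^k` of the fine count),
`|E_k(w)(b, b′)| ≤ w₀·c·e^{−δ|b − b′|}` — the socket's (H2′) letter for the perturbation, LINEAR in the potential's size;
(TWO-SPACING) for potentials `w` (run `L^k`) and `w′` (run `L·L^k`) bounded by `w₀` with COHERENCE DEFECT `|w′(x′) − w(x)| ≤ ν` (`x` under `x′`),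
`|E_{k+1}(w′)(b, b′) − E_k(w)(b, b′)| ≤ c·(w₀·(L^{−1∕2})^k + ν)·e^{−δ|b − b′|}` — King's printed minimiser rate PLUS the potentials'
coherence defect, WITH decay (stronger than the socket's sup-norm (H3) letter).  Inputs BY NAME: `minimiser_row_decay`,
`king_prop38_torus_blocks`, `outerRate_le_unif`; mechanism = part 8a §1–§3. [cite: King1986, Theorem 3.3 (3.7) p.658, Prop. 3.8 (3.71) p.664, (4.41) p.675] -/
theorem potLevel_letters_kingU (hLodd : Odd L) (hL : 2 ≤ L) {a m2 : ℝ} (ha : 0 < a) (hm : 0 < m2) :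
    ∃ δ c : ℝ, 0 < δ ∧ 0 < c ∧ ∀ (e k : ℕ), 1 ≤ k →
      (∀ (N : ℕ) [NeZero N], N = L ^ k → ∀ (w : Tor (fine N (kingU d L e)) → ℝ) (w₀ : ℝ), (∀ x, |w x| ≤ w₀) →
        ∀ b b' : Tor (kingU d L e), |potLevel L (kingU d L e) a m2 N k w b b'| ≤ w₀ * c * Real.exp (-(δ * tdistT (kingU d L e) b b'))) ∧
      (∀ (w : Tor (fine (L ^ k) (kingU d L e)) → ℝ) (w' : Tor (fine (L ^ 1 * L ^ k) (kingU d L e)) → ℝ) (w₀ ν : ℝ),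
        (∀ x, |w x| ≤ w₀) → (∀ x', |w' x'| ≤ w₀) → (∀ x', |w' x' - w (underPtN L k 1 (kingU d L e) x')| ≤ ν) →
        ∀ b b' : Tor (kingU d L e),
          |potLevel L (kingU d L e) a m2 (L ^ 1 * L ^ k) (k + 1) w' b b' - potLevel L (kingU d L e) a m2 (L ^ k) k w b b'|
            ≤ c * (w₀ * ((L : ℝ) ^ (-(1 / 2 : ℝ))) ^ k + ν) * Real.exp (-(δ * tdistT (kingU d L e) b b'))) := by
  obtain ⟨δ₁, c₁, hδ₁, hc₁, H₁⟩ := kingH_decay_kingU (d := d) L hLodd hL ha hm.le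
  obtain ⟨δ₂, C₂, hδ₂, hC₂, H₂⟩ := kingH_step_kingU (d := d) L hLodd hL ha hm
  set δm : ℝ := min δ₁ δ₂ with hδm
  have hδm0 : 0 < δm := lt_min hδ₁ hδ₂
  have hm1 : δm ≤ δ₁ := min_le_left _ _
  have hm2 : δm ≤ δ₂ := min_le_right _ _
  set K : ℝ := latticeConst (d + 1) (δm / 2) with hK
  have hK0 : 0 ≤ K := latticeConst_nonneg (d + 1) (half_pos hδm0).le
  set s : ℝ := (L : ℝ) ^ (-(1 / 2 : ℝ)) with hs_def
  have hs : 0 ≤ s := Real.rpow_nonneg (Nat.cast_nonneg _) _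
  refine ⟨δm / 2, (2 * c₁ * C₂ + c₁ ^ 2) * K + 1, half_pos hδm0, by positivity, fun e k hk => ⟨fun N _ hN w w₀ hw b b' => ?_,
    fun w w' w₀ ν hw hw' hcoh b b' => ?_⟩⟩
  · -- locality at the common rate
    have hpd := tdistT_isPseudoDist (kingU d L e)
    have hw0 : 0 ≤ w₀ := (abs_nonneg _).trans (hw (fun μ => 0))
    have hH : ∀ (b : Tor (kingU d L e)) (x : Tor (fine N (kingU d L e))),
        |kingH L N (kingU d L e) a m2 k b x| ≤ c₁ * Real.exp (-(δm * tdistT (kingU d L e) (blockOf N (kingU d L e) x) b)) :=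
      fun b x => decay_mono hc₁.le hm1 (hpd.nonneg _ _) (H₁ e k hk N hN b x)
    calc |potLevel L (kingU d L e) a m2 N k w b b'| ≤ w₀ * c₁ ^ 2 * K * Real.exp (-(δm / 2 * tdistT (kingU d L e) b b')) :=
          potLevel_entry_le hc₁.le hδm0 hH hw b b'
      _ ≤ w₀ * ((2 * c₁ * C₂ + c₁ ^ 2) * K + 1) * Real.exp (-(δm / 2 * tdistT (kingU d L e) b b')) := by
          refine mul_le_mul_of_nonneg_right ?_ (Real.exp_pos _).le
          have h2 : c₁ ^ 2 * K ≤ (2 * c₁ * C₂ + c₁ ^ 2) * K + 1 := by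
            nlinarith [mul_nonneg (mul_nonneg (mul_nonneg (by norm_num : (0 : ℝ) ≤ 2) hc₁.le) hC₂.le) hK0]
          calc w₀ * c₁ ^ 2 * K = w₀ * (c₁ ^ 2 * K) := by ring
            _ ≤ w₀ * ((2 * c₁ * C₂ + c₁ ^ 2) * K + 1) := mul_le_mul_of_nonneg_left h2 hw0
  · -- two-spacing at the common rate
    have hpd := tdistT_isPseudoDist (kingU d L e)
    have hw0 : 0 ≤ w₀ := (abs_nonneg _).trans (hw (fun μ => 0))
    have hν0 : 0 ≤ ν := (abs_nonneg _).trans (hcoh (fun μ => 0))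
    have hH : ∀ (b : Tor (kingU d L e)) (x : Tor (fine (L ^ k) (kingU d L e))),
        |kingH L (L ^ k) (kingU d L e) a m2 k b x| ≤ c₁ * Real.exp (-(δm * tdistT (kingU d L e) (blockOf (L ^ k) (kingU d L e) x) b)) :=
      fun b x => decay_mono hc₁.le hm1 (hpd.nonneg _ _) (H₁ e k hk (L ^ k) rfl b x)
    have hH' : ∀ (b : Tor (kingU d L e)) (x' : Tor (fine (L ^ 1 * L ^ k) (kingU d L e))),
        |kingH L (L ^ 1 * L ^ k) (kingU d L e) a m2 (k + 1) b x'|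
          ≤ c₁ * Real.exp (-(δm * tdistT (kingU d L e) (blockOf (L ^ 1 * L ^ k) (kingU d L e) x') b)) :=
      fun b x' => decay_mono hc₁.le hm1 (hpd.nonneg _ _) (H₁ e (k + 1) (by omega) (L ^ 1 * L ^ k) (by ring) b x')
    have hstep : ∀ (b : Tor (kingU d L e)) (x' : Tor (fine (L ^ 1 * L ^ k) (kingU d L e))),
        |kingH L (L ^ 1 * L ^ k) (kingU d L e) a m2 (k + 1) b x' - kingH L (L ^ k) (kingU d L e) a m2 k b (underPtN L k 1 (kingU d L e) x')|
          ≤ C₂ * s ^ k * Real.exp (-(δm * tdistT (kingU d L e) (blockOf (L ^ 1 * L ^ k) (kingU d L e) x') b)) :=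
      fun b x' => decay_mono (mul_nonneg hC₂.le (pow_nonneg hs _)) hm2 (hpd.nonneg _ _) (H₂ e k hk b x')
    calc |potLevel L (kingU d L e) a m2 (L ^ 1 * L ^ k) (k + 1) w' b b' - potLevel L (kingU d L e) a m2 (L ^ k) k w b b'|
        ≤ (2 * w₀ * c₁ * C₂ * s ^ k + c₁ ^ 2 * ν) * K * Real.exp (-(δm / 2 * tdistT (kingU d L e) b b')) :=
          potLevel_sub_entry_le hc₁.le hC₂.le (pow_nonneg hs _) hδm0 hH hH' hstep hw hw' hcoh b b'
      _ ≤ ((2 * c₁ * C₂ + c₁ ^ 2) * K + 1) * (w₀ * s ^ k + ν) * Real.exp (-(δm / 2 * tdistT (kingU d L e) b b')) := by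
          refine mul_le_mul_of_nonneg_right ?_ (Real.exp_pos _).le
          have h1 : 0 ≤ w₀ * s ^ k := mul_nonneg hw0 (pow_nonneg hs _)
          nlinarith [mul_nonneg (mul_nonneg hc₁.le hC₂.le) hK0, mul_nonneg (sq_nonneg c₁) hK0, mul_nonneg h1 hν0,
            mul_nonneg (mul_nonneg (sq_nonneg c₁) hK0) h1, mul_nonneg (mul_nonneg (mul_nonneg hc₁.le hC₂.le) hK0) hν0]

end King

/-! ## §5 The letters of the TOWER generated by a bounded, coherent potential tower -/

section TowerLetters

open Real

variable (L : ℕ) [NeZero L]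

/-- **THE SOCKET's TWO LETTERS FOR THE PERTURBATION TOWER OF A POTENTIAL TOWER, AS THEOREMS** (odd `L ≥ 3`, `a, m² > 0`): there are `κ, c > 0`
such that on every King-admissible torus, for every potential tower `v` of SIZE `sup|v_N| ≤ w₀` whose COHERENCE DEFECT across one block-spin step is
`sup_{x′} |v_{L·L^k}(x′) − v_{L^k}(x under x′)| ≤ ν₀·s^k` (`k ≥ 1`, `0 ≤ s ≤ L^{−1∕2}`, `ν₀ ≥ 0`): the generated tower `E(v)` is k-uniformly LOCAL,
`UniformKernelDecay (potTower v) |·|_T (w₀·c) κ` (the (H2′) letter), and has the geometric ONE-STEP SUP RATE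
`EffectiveOperatorSupRate (potTower v) (c·(w₀ + ν₀)) L^{−1∕2}` (the (H3) letter) — BOTH DERIVED from King's printed minimiser estimates (§4), the
(3.35)∕(3.36)-type data entering only as the size and the coherence of the potential. [cite: King1986, Theorem 3.3 (3.7) p.658, Prop. 3.8 (3.71) p.664, Lemma 4.3 (4.18) p.672 (the free tower's own (H3))] -/
theorem potTower_letters_kingU (hLodd : Odd L) (hL : 2 ≤ L) {a m2 : ℝ} (ha : 0 < a) (hm : 0 < m2) :
    ∃ κ c : ℝ, 0 < κ ∧ 0 < c ∧ ∀ (e : ℕ) (v : ∀ N : ℕ, Tor (fine N (kingU d L e)) → ℝ) (w₀ : ℝ),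
      (∀ (N : ℕ) (x : Tor (fine N (kingU d L e))), |v N x| ≤ w₀) →
      UniformKernelDecay (potTower L (kingU d L e) a m2 v) (tdistT (kingU d L e)) (w₀ * c) κ ∧
      ∀ (ν₀ s : ℝ), 0 ≤ ν₀ → 0 ≤ s → s ≤ (L : ℝ) ^ (-(1 / 2 : ℝ)) →
        (∀ (k : ℕ), 1 ≤ k → ∀ x' : Tor (fine (L ^ 1 * L ^ k) (kingU d L e)),
            |v (L ^ 1 * L ^ k) x' - v (L ^ k) (underPtN L k 1 (kingU d L e) x')| ≤ ν₀ * s ^ k) →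
        EffectiveOperatorSupRate (potTower L (kingU d L e) a m2 v) (c * (w₀ + ν₀)) ((L : ℝ) ^ (-(1 / 2 : ℝ))) := by
  obtain ⟨δ, c, hδ, hc, H⟩ := potLevel_letters_kingU (d := d) L hLodd hL ha hm
  refine ⟨δ / 2, c, half_pos hδ, hc, fun e v w₀ hsize => ⟨fun j z w => ?_, fun ν₀ s hν0 hs0 hs1 hcoh j z w => ?_⟩⟩
  · -- locality at level `max j 1 ≥ 1`
    have hj : 1 ≤ max j 1 := le_max_right _ _
    have h := (H e (max j 1) hj).1 (L ^ max j 1) rfl (v (L ^ max j 1)) w₀ (fun x => hsize _ x) z w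
    show |potLevel L (kingU d L e) a m2 (L ^ max j 1) (max j 1) (v (L ^ max j 1)) z w| ≤ _
    rw [show (2 : ℝ) * (δ / 2) = δ by ring]
    exact h
  · -- the one-step sup rate
    set r : ℝ := (L : ℝ) ^ (-(1 / 2 : ℝ)) with hr_def
    have hr : 0 ≤ r := rpow_nonneg (Nat.cast_nonneg _) _
    have hw0 : 0 ≤ w₀ := (abs_nonneg _).trans (hsize 1 (fun μ => 0))
    rcases Nat.eq_zero_or_pos j with rfl | hj
    · rw [zero_add, ← potTower_zero, sub_self, Matrix.zero_apply, abs_zero, pow_zero, mul_one]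
      exact mul_nonneg hc.le (add_nonneg hw0 hν0)
    · rw [potTower_succ_sub v hj]
      have hpd := tdistT_isPseudoDist (kingU d L e)
      have h := (H e j hj).2 (v (L ^ j)) (v (L ^ 1 * L ^ j)) w₀ (ν₀ * s ^ j) (fun x => hsize _ x) (fun x' => hsize _ x') (hcoh j hj) z w
      have hsr : s ^ j ≤ r ^ j := pow_le_pow_left₀ hs0 hs1 j
      have hexp : Real.exp (-(δ * tdistT (kingU d L e) z w)) ≤ 1 :=
        Real.exp_le_one_iff.mpr (by nlinarith [hpd.nonneg z w])
      have hX : 0 ≤ c * (w₀ * r ^ j + ν₀ * s ^ j) := by positivity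
      calc |potLevel L (kingU d L e) a m2 (L ^ 1 * L ^ j) (j + 1) (v (L ^ 1 * L ^ j)) z w
              - potLevel L (kingU d L e) a m2 (L ^ j) j (v (L ^ j)) z w|
          ≤ c * (w₀ * r ^ j + ν₀ * s ^ j) * Real.exp (-(δ * tdistT (kingU d L e) z w)) := h
        _ ≤ c * (w₀ * r ^ j + ν₀ * s ^ j) := mul_le_of_le_one_right hX hexp
        _ ≤ c * (w₀ + ν₀) * r ^ j := by
            have : ν₀ * s ^ j ≤ ν₀ * r ^ j := mul_le_mul_of_nonneg_left hsr hν0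
            nlinarith [hc.le]

end TowerLetters

/-! ## §6 Monotonicity of the socket's leaves in the rate and the ratio; positivity of the lattice-sum profile -/

section Mono

variable {n : Type*} [Fintype n] [DecidableEq n] {D : ℕ → Matrix n n ℝ} {B : Matrix n n ℝ} {dm : n → n → ℝ}

omit [Fintype n] [DecidableEq n] in
/-- (H2′) weakens with the rate. [folklore] -/
theorem uniformKernelDecay_mono_rate {C κ κ' : ℝ} (hC : 0 ≤ C) (hκ : κ' ≤ κ) (hd : ∀ z w, 0 ≤ dm z w)
    (h : UniformKernelDecay D dm C κ) : UniformKernelDecay D dm C κ' :=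
  fun k z w => (h k z w).trans (mul_le_mul_of_nonneg_left (Real.exp_le_exp.mpr (by nlinarith [hd z w])) hC)

omit [DecidableEq n] in
/-- The Combes–Thomas row weight grows with the rate. [folklore] -/
theorem wRow_mono_rate (M : Matrix n n ℝ) {κ κ' : ℝ} (hκ : κ' ≤ κ) (hd : ∀ z w, 0 ≤ dm z w) (i : n) :
    wRow M dm κ' i ≤ wRow M dm κ i :=
  sum_le_sum fun j _ => mul_le_mul_of_nonneg_left
    (sub_le_sub_right (Real.exp_le_exp.mpr (mul_le_mul_of_nonneg_right hκ (hd i j))) 1) (abs_nonneg _)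

omit [DecidableEq n] in
/-- The Combes–Thomas column weight grows with the rate. [folklore] -/
theorem wCol_mono_rate (M : Matrix n n ℝ) {κ κ' : ℝ} (hκ : κ' ≤ κ) (hd : ∀ z w, 0 ≤ dm z w) (j : n) :
    wCol M dm κ' j ≤ wCol M dm κ j :=
  sum_le_sum fun i _ => mul_le_mul_of_nonneg_left
    (sub_le_sub_right (Real.exp_le_exp.mpr (mul_le_mul_of_nonneg_right hκ (hd i j))) 1) (abs_nonneg _)

omit [DecidableEq n] in
/-- (H2) weakens with the rate. [folklore] -/
theorem uniformCTBound_mono_rate {κ κ' ρ ρB : ℝ} (hκ : κ' ≤ κ) (hd : ∀ z w, 0 ≤ dm z w) (h : UniformCTBound D B dm κ ρ ρB) :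
    UniformCTBound D B dm κ' ρ ρB :=
  ⟨fun k i => (wRow_mono_rate (D k) hκ hd i).trans (h.1 k i), fun k j => (wCol_mono_rate (D k) hκ hd j).trans (h.2.1 k j),
    fun i => (wRow_mono_rate B hκ hd i).trans (h.2.2.1 i), fun j => (wCol_mono_rate B hκ hd j).trans (h.2.2.2 j)⟩

omit [Fintype n] [DecidableEq n] in
/-- (H3) weakens with the ratio. [folklore] -/
theorem effectiveOperatorSupRate_mono_rate {ε r r' : ℝ} (hε : 0 ≤ ε) (hr : 0 ≤ r) (hrr : r ≤ r') (h : EffectiveOperatorSupRate D ε r) :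
    EffectiveOperatorSupRate D ε r' :=
  fun k z w => (h k z w).trans (mul_le_mul_of_nonneg_left (pow_le_pow_left₀ hr hrr k) hε)

/-- The lattice-sum profile is positive (read `tdistT_sumBound` on the one-point torus: the sum contains the term `1`). [folklore] -/
theorem latticeConst_pos (dd : ℕ) {κ : ℝ} (hκ : 0 < κ) : 0 < latticeConst dd κ := by
  have h := tdistT_sumBound (fun _ : Fin dd => (1 : ℕ)) κ hκ 0
  have hs := Finset.single_le_sum (s := Finset.univ)
    (f := fun y : Tor (fun _ : Fin dd => (1 : ℕ)) => Real.exp (-(κ * tdistT (fun _ : Fin dd => (1 : ℕ)) 0 y)))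
    (fun y _ => (Real.exp_pos _).le) (Finset.mem_univ 0)
  have h0 : Real.exp (-(κ * tdistT (fun _ : Fin dd => (1 : ℕ)) 0 0)) = 1 := by
    rw [(tdistT_isPseudoDist _).zero, mul_zero, neg_zero, Real.exp_zero]
  rw [h0] at hs
  linarith

end Mono

end Summit.QuantumFields.YangMills.BalabanUVNodes.N15.KingModel

end
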